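import Summits.AtomisticToContinuum.HydrodynamicLimit.Theorems.CollisionIsometryCLTAdaptedWeightCLTTLColumnDepolarisationPieces
import Summits.AtomisticToContinuum.HydrodynamicLimit.Theorems.CollisionIsometryCLTAdaptedWeightCLTTLColumnDepolarisationBalance

/-!
# Column depolarisation, part A2: the a-priori bounds `0 ≤ cd2 ≤ 6`, `0 ≤ cd3x ≤ 78`
(helpers for the registered stub `stub_columnDepolarisation` of the line `contact-source-duhamel`,
crux `CollisionIsometryCLT.AdaptedWeightCLT`, stmt-AtomisticToContinuum-14868; `--supports`,
anchor `cd2_le_six`)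

From the piece representation of part A1 (`cloud_eq_sum_pieces`, `pieces_energy`): the rank-`r`
cloud of an impulse `a` is `Σ_w (vec w)^{⊗r}` with `Σ_w ‖vec w‖² = ‖a‖²`, hence by the triangle
inequality in squared form (`normSqT_sum_le`, Cauchy–Schwarz) and `‖m^{⊗r}‖ = ‖m‖^r`
(`normSqT_tpow`):
* rank 2: `‖cloud₂ − |a|²𝟙/3‖² = ‖cloud₂‖² − 2⟨cloud₂, |a|²𝟙/3⟩ + |a|⁴/3 ≤ |a|⁴ − (2/3)|a|⁴ + |a|⁴/3
  = (2/3)|a|⁴` (`normSqT_cloud_two_sub_iso2_le`), so `0 ≤ cd2 ≤ 9 · 2/3 = 6` for the nine unit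
  probes `dirV` (`cd2_nonneg`, `cd2_le_six` — the bound announced in the docstring of `cd2`);
* rank 3: `‖cloud₃‖² ≤ (Σ_w ‖vec w‖³)² ≤ (‖a‖ Σ_w ‖vec w‖²)² = |a|⁶` (`normSqT_cloud_three_le`), so
  `0 ≤ cd3x ≤ Σ_p ‖udir p‖⁶ = 3·1 + 6·8 + 27 = 78` (`cd3x_nonneg`, `cd3x_le`).
These are the dominations needed for the dominated convergence in `s` of `stub_pastDamping`.
-/

namespace Summit.AtomisticToContinuum.HydrodynamicLimit.Theorems.ContactSourceDuhamel.TimeLocal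
namespace ColumnDepolarisation

open scoped BigOperators Topology Classical MeasureTheory ENNReal InnerProductSpace
open Filter Set MeasureTheory
open Literature.Analysis.FluidPDE
open Literature.MathematicalPhysics.KineticTheory (hsDiameter)
open Duhamel

noncomputable section

variable {σ : ℝ} {N : ℕ} {y : Cfg N} {r : ℕ}

/-! ## Norms and pairings of tensors -/

/-- `‖m^{⊗r}‖² = (‖m‖²)^r`. -/
theorem normSqT_tpow (m : V3) : normSqT (tpow r m) = (‖m‖ ^ 2) ^ r := by
  simp only [normSqT, tpow]
  calc ∑ idx : Fin r → Fin 3, (∏ s, m (idx s)) ^ 2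
        = ∑ idx : Fin r → Fin 3, ∏ s, (m (idx s)) ^ 2 := by
          refine Finset.sum_congr rfl fun idx _ => ?_
          rw [Finset.prod_pow]
    _ = ∏ _s : Fin r, ∑ b : Fin 3, (m b) ^ 2 :=
          (Fintype.prod_sum (fun (_ : Fin r) (b : Fin 3) => (m b) ^ 2)).symm
    _ = (‖m‖ ^ 2) ^ r := by
          rw [Finset.prod_const, Finset.card_univ, Fintype.card_fin, sum_sq_eq_norm_sq]

/-- `√(‖m^{⊗r}‖²) = ‖m‖^r`. -/
theorem sqrt_normSqT_tpow (m : V3) : Real.sqrt (normSqT (tpow r m)) = ‖m‖ ^ r := by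
  rw [normSqT_tpow, ← pow_mul, show 2 * r = r * 2 by ring, pow_mul,
    Real.sqrt_sq (pow_nonneg (norm_nonneg _) _)]

/-- `normSqT` is nonnegative. -/
theorem normSqT_nonneg (T : Tens r) : 0 ≤ normSqT T :=
  Finset.sum_nonneg fun _ _ => sq_nonneg _

/-- Cauchy–Schwarz for the tensor pairing. -/
theorem abs_pairT_le (X Y : Tens r) :
    |pairT X Y| ≤ Real.sqrt (normSqT X) * Real.sqrt (normSqT Y) := by
  have h : (pairT X Y) ^ 2 ≤ normSqT X * normSqT Y :=
    Finset.sum_mul_sq_le_sq_mul_sq _ _ _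
  rw [← Real.sqrt_mul (normSqT_nonneg X)]
  exact Real.abs_le_sqrt h

/-- `pairT` is additive on the left over finite sums. -/
theorem pairT_sum_left {ι : Type*} (s : Finset ι) (X : ι → Tens r) (Y : Tens r) :
    pairT (∑ w ∈ s, X w) Y = ∑ w ∈ s, pairT (X w) Y := by
  simp only [pairT, Finset.sum_apply, Finset.sum_mul]
  rw [Finset.sum_comm]

/-- `pairT` is additive on the right over finite sums. -/
theorem pairT_sum_right {ι : Type*} (s : Finset ι) (X : Tens r) (Y : ι → Tens r) :
    pairT X (∑ w ∈ s, Y w) = ∑ w ∈ s, pairT X (Y w) := by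
  simp only [pairT, Finset.sum_apply, Finset.mul_sum]
  rw [Finset.sum_comm]

/-- `‖T‖² = ⟨T, T⟩`. -/
theorem normSqT_eq_pairT (T : Tens r) : normSqT T = pairT T T := by
  simp only [normSqT, pairT, sq]

/-- The triangle inequality in squared form: `‖Σ_w X_w‖² ≤ (Σ_w ‖X_w‖)²`. -/
theorem normSqT_sum_le {ι : Type*} (s : Finset ι) (X : ι → Tens r) :
    normSqT (∑ w ∈ s, X w) ≤ (∑ w ∈ s, Real.sqrt (normSqT (X w))) ^ 2 := by
  rw [normSqT_eq_pairT, pairT_sum_left]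
  simp_rw [pairT_sum_right]
  rw [sq, Finset.sum_mul_sum]
  refine Finset.sum_le_sum fun w _ => Finset.sum_le_sum fun w' _ => ?_
  exact (le_abs_self _).trans (abs_pairT_le _ _)

/-! ## Bounds on the clouds -/

/-- Rank 3: `‖cloud₃(k, a)‖² ≤ ‖a‖⁶`. -/
theorem normSqT_cloud_three_le (m : ℕ) (k : Fin (N + 1)) (a : V3) :
    normSqT (cloud 3 σ N y m k a) ≤ (‖a‖ ^ 2) ^ 3 := by
  rw [cloud_eq_sum_pieces (by norm_num) m k a]
  refine (normSqT_sum_le _ _).trans ?_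
  simp only [sqrt_normSqT_tpow]
  have hE := pieces_energy (σ := σ) (y := y) k a m
  have h3 : ∑ w : Fin m → Bool, ‖pieceVec σ N y k a m w‖ ^ 3 ≤ ‖a‖ * ‖a‖ ^ 2 := by
    calc ∑ w : Fin m → Bool, ‖pieceVec σ N y k a m w‖ ^ 3
          = ∑ w : Fin m → Bool, ‖pieceVec σ N y k a m w‖ * ‖pieceVec σ N y k a m w‖ ^ 2 :=
            Finset.sum_congr rfl fun w _ => by ring
      _ ≤ ∑ w : Fin m → Bool, ‖a‖ * ‖pieceVec σ N y k a m w‖ ^ 2 :=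
            Finset.sum_le_sum fun w _ =>
              mul_le_mul_of_nonneg_right (norm_pieceVec_le k a m w) (sq_nonneg _)
      _ = ‖a‖ * ‖a‖ ^ 2 := by rw [← Finset.mul_sum, hE]
  calc (∑ w : Fin m → Bool, ‖pieceVec σ N y k a m w‖ ^ 3) ^ 2 ≤ (‖a‖ * ‖a‖ ^ 2) ^ 2 :=
        pow_le_pow_left₀ (Finset.sum_nonneg fun _ _ => pow_nonneg (norm_nonneg _) _) h3 2
    _ = (‖a‖ ^ 2) ^ 3 := by ring

/-- `⟨m ⊗ m, |a|²𝟙/3⟩ = |a|² ‖m‖²/3`. -/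
theorem pairT_tpow_two_iso2 (m a : V3) : pairT (tpow 2 m) (iso2 a) = ‖a‖ ^ 2 / 3 * ‖m‖ ^ 2 := by
  simp only [pairT, tpow, iso2, Fin.prod_univ_two]
  rw [← Fintype.sum_equiv (finTwoArrowEquiv (Fin 3)).symm
    (fun ij => (m ij.1 * m ij.2) * (if ij.1 = ij.2 then ‖a‖ ^ 2 / 3 else 0)) _ (fun _ => rfl),
    Fintype.sum_prod_type]
  simp only [mul_ite, mul_zero, Finset.sum_ite_eq, Finset.mem_univ, if_true]
  rw [← sum_sq_eq_norm_sq m, Finset.mul_sum]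
  exact Finset.sum_congr rfl fun i _ => by ring

/-- `‖|a|²𝟙/3‖² = |a|⁴/3`. -/
theorem normSqT_iso2 (a : V3) : normSqT (iso2 a) = (‖a‖ ^ 2) ^ 2 / 3 := by
  simp only [normSqT, iso2]
  rw [← Fintype.sum_equiv (finTwoArrowEquiv (Fin 3)).symm
    (fun ij => (if ij.1 = ij.2 then ‖a‖ ^ 2 / 3 else 0) ^ 2) _ (fun _ => rfl),
    Fintype.sum_prod_type]
  simp only [ite_pow, ne_eq, OfNat.ofNat_ne_zero, not_false_eq_true, zero_pow, Finset.sum_ite_eq,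
    Finset.mem_univ, if_true, Finset.sum_const, Finset.card_univ, Fintype.card_fin, nsmul_eq_mul,
    Nat.cast_ofNat]
  ring

/-- Rank 2: `‖cloud₂(k, a) − |a|²𝟙/3‖² ≤ (2/3)‖a‖⁴`. -/
theorem normSqT_cloud_two_sub_iso2_le (m : ℕ) (k : Fin (N + 1)) (a : V3) :
    normSqT (cloud 2 σ N y m k a - iso2 a) ≤ 2 / 3 * (‖a‖ ^ 2) ^ 2 := by
  rw [normSqT_sub']
  have hc : cloud 2 σ N y m k a = ∑ w : Fin m → Bool, tpow 2 (pieceVec σ N y k a m w) :=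
    cloud_eq_sum_pieces (by norm_num) m k a
  have h1 : normSqT (cloud 2 σ N y m k a) ≤ (‖a‖ ^ 2) ^ 2 := by
    rw [hc]
    refine (normSqT_sum_le _ _).trans ?_
    simp only [sqrt_normSqT_tpow]
    rw [pieces_energy]
  have h2 : pairT (cloud 2 σ N y m k a) (iso2 a) = ‖a‖ ^ 2 / 3 * ‖a‖ ^ 2 := by
    rw [hc, pairT_sum_left]
    simp only [pairT_tpow_two_iso2]
    rw [← Finset.mul_sum, pieces_energy]
  rw [h2, normSqT_iso2]
  nlinarith [h1]

/-! ## The bounds on `cd2` and `cd3x` -/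

/-- The probe directions are unit vectors. -/
theorem norm_dirV (p q : Fin 3) : ‖dirV p q‖ = 1 := by
  have h1 : (baseV p + baseV q) p ≠ 0 := by
    simp [baseV]
    split_ifs <;> norm_num
  have hne : baseV p + baseV q ≠ 0 := fun h => h1 (by simp [h])
  rw [dirV, norm_smul, norm_inv, norm_norm, inv_mul_cancel₀ (norm_ne_zero_iff.2 hne)]

/-- `0 ≤ cd2`. -/
theorem cd2_nonneg (Δ : ℝ) : 0 ≤ cd2 σ N y Δ :=
  mul_nonneg (inv_nonneg.2 (Nat.cast_nonneg _)) (Finset.sum_nonneg fun _ _ =>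
    Finset.sum_nonneg fun _ _ => Finset.sum_nonneg fun _ _ => normSqT_nonneg _)

/-- `cd2 ≤ 6` (`= 9 · 2/3`: nine unit probes per injection site, each cloud within `2/3` of
isotropy in squared Frobenius distance). -/
theorem cd2_le_six : ∀ (σ : ℝ) (N : ℕ) (y : Cfg N) (Δ : ℝ), cd2 σ N y Δ ≤ 6 := by
  intro σ N y Δ
  unfold cd2
  have hb : ∀ (k : Fin (N + 1)) (p q : Fin 3),
      normSqT (cloud 2 σ N y (steps σ N y Δ) k (dirV p q) - iso2 (dirV p q)) ≤ 2 / 3 := by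
    intro k p q
    have h := normSqT_cloud_two_sub_iso2_le (σ := σ) (y := y) (steps σ N y Δ) k (dirV p q)
    rw [norm_dirV] at h
    norm_num at h
    exact h
  have hN : (0 : ℝ) < ((N + 1 : ℕ) : ℝ) := by positivity
  calc ((N + 1 : ℕ) : ℝ)⁻¹ * ∑ k : Fin (N + 1), ∑ p : Fin 3, ∑ q : Fin 3,
          normSqT (cloud 2 σ N y (steps σ N y Δ) k (dirV p q) - iso2 (dirV p q))
        ≤ ((N + 1 : ℕ) : ℝ)⁻¹ * ∑ _k : Fin (N + 1), ∑ _p : Fin 3, ∑ _q : Fin 3, (2 / 3 : ℝ) := by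
          gcongr with k _ p _ q _
          exact hb k p q
    _ = 6 := by
          simp only [Finset.sum_const, Finset.card_univ, Fintype.card_fin, nsmul_eq_mul]
          push_cast
          field_simp
          ring

/-- `0 ≤ cd3x`. -/
theorem cd3x_nonneg (Δ : ℝ) : 0 ≤ cd3x σ N y Δ :=
  mul_nonneg (inv_nonneg.2 (Nat.cast_nonneg _)) (Finset.sum_nonneg fun _ _ =>
    Finset.sum_nonneg fun _ _ => normSqT_nonneg _)

/-- The sixth powers of the lengths of the ten cubic probes add up to `78 = 3·1 + 6·8 + 27`. -/
theorem sum_norm_udir_pow_six : ∑ p : Fin 10, (‖udir p‖ ^ 2) ^ 3 = 78 := by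
  have h0 : ∀ v : V3, ‖v‖ ^ 2 = v 0 ^ 2 + v 1 ^ 2 + v 2 ^ 2 := fun v => by
    rw [EuclideanSpace.real_norm_sq_eq, Fin.sum_univ_three]
  simp only [Fin.sum_univ_succ, Fin.sum_univ_zero, h0, udir, baseV]
  simp [Fin.succ]
  norm_num

/-- `cd3x ≤ 78`. -/
theorem cd3x_le : ∀ (σ : ℝ) (N : ℕ) (y : Cfg N) (Δ : ℝ), cd3x σ N y Δ ≤ 78 := by
  intro σ N y Δ
  unfold cd3x
  have hN : (0 : ℝ) < ((N + 1 : ℕ) : ℝ) := by positivity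
  calc ((N + 1 : ℕ) : ℝ)⁻¹ * ∑ k : Fin (N + 1), ∑ p : Fin 10,
          normSqT (cloud 3 σ N y (steps σ N y Δ) k (udir p))
        ≤ ((N + 1 : ℕ) : ℝ)⁻¹ * ∑ _k : Fin (N + 1), ∑ p : Fin 10, (‖udir p‖ ^ 2) ^ 3 := by
          gcongr with k _ p _
          exact normSqT_cloud_three_le _ _ _
    _ = 78 := by
          rw [sum_norm_udir_pow_six]
          simp only [Finset.sum_const, Finset.card_univ, Fintype.card_fin, nsmul_eq_mul]
          push_cast
          field_simp

/-- `0 ≤ cd2 + cd3x ≤ 84` (the window functional the past-damping estimate integrates in time; appended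
for the v2 stub `stub_pastDamping`). -/
theorem cd2_add_cd3x_mem (σ : ℝ) (N : ℕ) (y : Cfg N) (Δ : ℝ) :
    0 ≤ cd2 σ N y Δ + cd3x σ N y Δ ∧ cd2 σ N y Δ + cd3x σ N y Δ ≤ 84 := by
  have h2 := cd2_le_six σ N y Δ
  have h3 := cd3x_le σ N y Δ
  exact ⟨add_nonneg (cd2_nonneg Δ) (cd3x_nonneg Δ), by linarith⟩

end

end ColumnDepolarisation
end Summit.AtomisticToContinuum.HydrodynamicLimit.Theorems.ContactSourceDuhamel.TimeLocal
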